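import Summits.BirchSwinnertonDyer.BirchSwinnertonDyer.Theorems.GenusKolyvaginAtTwoOffCutResidualAtTwoRLw2TateKummer
import HarnessLib

/-!
# Route `GenusKolyvaginAtTwo`, residual `OffCutResidualAtTwoR` (stmt-BirchSwinnertonDyer-31767), LINE 26 «lw2_phantom_exclusion» /
# LINE 33–34 F4′: THE TATE WITNESS AT A MULTIPLICATIVE PLACE OF ANY RESIDUE CHARACTERISTIC — part 2, the LOCAL theorem on `W(K̄_v)`

Width seat `bsd-line-gk2-p5` g41 (cell `bsd-f1-sign2`), `--supports stmt-BirchSwinnertonDyer-31767 --as helper`.  ONE THEOREM (no definition,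
no named fact, no `sorry`).  **BSD is NOT proved by this file; nothing is closed by it.**

`TateFour.exists_tateWitness_localPoints`: for `W/K` elliptic over a number field (universe `0`, the Tate-curve stack) and `v` a place of
MULTIPLICATIVE reduction — split or non-split, ANY residue characteristic, in particular `v ∣ 2` — with `ord_v Δ_min` ODD, there is `τ ∈ Γ_{K_v}`
such that
  (i) `τ • (τ • P − P) = τ • P − P` for every `P ∈ W(K̄_v)` with `4P = O` (unipotent on the `4`-torsion);
  (ii) `τ` MOVES some `P` with `2P = O`;
  (iii) for every `P ∈ W(K̄_v)` whose `4P` is `K_v`-rational — i.e. for every local Kummer cocycle `σ ↦ σP − P` of level `4` — the value at `τ`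
       is principal: `τP − P = τM − M` with `4M = O`.
Proof = Silverman's proof of ATAEC Prop. V.6.1 at `p = 2` and level `4`, read through the TWISTED uniformisation (Lemma V.5.2 (c), Thm. V.5.3,
`smul_eq_sign_smul`) and Tate's `φ : K̄_v^× → E_q(K̄_v)` (Thm. V.3.1 (c),(d), `uniformization_holds`, INCLUDING its rational-points clause (d)
for `L = K_v(t)`): part 1's Kummer step gives `τ` fixing `i`, `t = √γ` (so `χ(τ) = 1` and `τ` commutes with `C : W ≅ E_q`) with
`τ Q = i^j Q`, `j` odd, `Q = q^{1/4}`; (i) every `4`-torsion point is `φ(u)` with `u⁴ ∈ q^ℤ`, so `τu/u ∈ μ₄ = ⟨i⟩` and `τφ(u) − φ(u) ∈ ℤφ(i)`,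
fixed by `τ`; (ii) `τφ(Q²) = φ(i^{2j}Q²) = φ(−1) + φ(Q²) ≠ φ(Q²)` as `−1 ∉ q^ℤ`; (iii) `4P = φ(u₀)` with `u₀ ∈ K_v(t)` fixed by `τ`, `P = φ(ρ₀) + m`
with `ρ₀⁴ = u₀`, `4m = O`, `τρ₀/ρ₀ = i^b`, and `b•φ(i) = (τ−1)((bj)•φ(Q))` because `j² ≡ 1 (mod 4)`.  The element `τ` is NOT asserted to be
inertial (at `v ∣ 2` it generally is not: the «V2-phantom» obstruction of the cell is inertia-only).  Consumed by part 3 (`…Lw2TateWitness`):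
the non-phantom lemma / level-2 witness at `v ∣ 2`.

References: [SilvermanATAEC1994] Thm. V.3.1 (c),(d), Lemma V.5.1, Lemma V.5.2 (c), Thm. V.5.3, proof of Prop. V.6.1 (PDF pp. 395–411);
[SilvermanAEC2009] Prop. VII.5.1 (b), X.§4 (proof of Thm. 4.2 (b)); [LawsonWuthrich2016] §7.1, §8.
-/

set_option linter.dupNamespace false -- tree convention: `Summit.BirchSwinnertonDyer.BirchSwinnertonDyer.Theorems` (summit = sub-problem)
set_option autoImplicit false

noncomputable section

open scoped Classical
open Field NumberField IsDedekindDomain WeierstrassCurve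

namespace Summit.BirchSwinnertonDyer.BirchSwinnertonDyer.Theorems.GenusExact.NonPhantom.TateFour

open Literature.NumberTheory.EllipticCurves Literature.NumberTheory.EllipticCurves.TateCurve
  Literature.NumberTheory.GaloisRepresentations SteinWuthrich2013

variable {K : Type} [Field K] [NumberField K] (W : WeierstrassCurve K) (v : HeightOneSpectrum (𝓞 K))

set_option maxHeartbeats 1600000 in
/-- **THE TATE WITNESS at a multiplicative place of ANY residue characteristic (local form).**  `W/K` elliptic over a number
field, `v` a place of multiplicative reduction (split or not, `v ∣ 2` allowed) with `ord_v Δ_min` ODD.  Then some `τ ∈ Γ_{K_v}`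
(i) acts unipotently on the `4`-torsion of `W(K̄_v)` (`τ(τP − P) = τP − P`), (ii) MOVES a `2`-torsion point, and (iii) for
every `P ∈ W(K̄_v)` with `4P` rational over `K_v` — i.e. for every local KUMMER cocycle `σ ↦ σP − P` of level `4` — the value
at `τ` is PRINCIPAL: `τP − P = τM − M` for a `4`-torsion point `M`.  Proof (Silverman's proof of ATAEC V.6.1 at `p = 2`, level
`4`, through the twisted Tate uniformisation `Ψ : K̄_v^× → W(K̄_v)`, kernel `q^ℤ`, `σΨ(u) = χ(σ)Ψ(σu)`): `ord_v q = ord_v Δ_min` is odd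
and `v(γ)` even, so `q ∉ {±1,±γ}K_v^{×2}` and the Kummer step gives `τ` fixing `i = √−1` and `t = √γ` (`χ(τ) = 1`) with
`τ q^{1/4} = i^j q^{1/4}`, `j` odd; every `4`-torsion point is `Ψ(u)`, `u⁴ ∈ q^ℤ`, so `τu/u ∈ μ₄` and `τ` is `(1 *; 0 1)`; `Ψ(q^{1/2})`
is moved (`i^{2j} = −1 ∉ q^ℤ`); and for `4P = Ψ(u₀)` rational, `u₀ ∈ K_v(t)` (ATAEC V.3.1 (d)), `P = Ψ(u₀^{1/4}) + m`, so
`τP − P ∈ Ψ(μ₄) + (τ−1)E[4] = (τ − 1)E[4]` because `(τ−1)Ψ(q^{b/4}) = Ψ(i^{jb})` exhausts `Ψ(μ₄)`.  NOT an inertial statement: at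
`v ∣ 2` the element `τ` need not lie in the inertia group (the «V2-phantom» obstruction is inertia-only).
[cite: SilvermanATAEC1994, Thm. V.3.1 (c),(d), Lemma V.5.1, V.5.2 (c), Thm. V.5.3, proof of Prop. V.6.1 (PDF pp. 395–411)]
[cite: SilvermanAEC2009, Prop. VII.5.1 (b)] -/
theorem exists_tateWitness_localPoints [W.IsElliptic] (hmult : W.HasMultiplicativeReductionAt v)
    (hodd : Odd (W.ordMinimalDiscriminant v)) :
    ∃ τ : absoluteGaloisGroup (v.adicCompletion K),
      (∀ P : localPoints W (v.adicCompletion K), (4 : ℤ) • P = 0 → τ • (τ • P - P) = τ • P - P) ∧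
      (∃ P : localPoints W (v.adicCompletion K), (2 : ℤ) • P = 0 ∧ τ • P ≠ P) ∧
      (∀ P : localPoints W (v.adicCompletion K),
        (∀ σ : absoluteGaloisGroup (v.adicCompletion K), σ • ((4 : ℤ) • P) = (4 : ℤ) • P) →
        ∃ M : localPoints W (v.adicCompletion K), (4 : ℤ) • M = 0 ∧ τ • P - P = τ • M - M) := by
  letI := Literature.NumberTheory.GaloisRepresentations.Ultrametric.AdicCompletion.nontriviallyNormedField K v
  haveI := charZero_adicCompletion' K v
  haveI : CharZero (AlgebraicClosure (v.adicCompletion K)) :=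
    charZero_of_injective_algebraMap
      (algebraMap (v.adicCompletion K) (AlgebraicClosure (v.adicCompletion K))).injective
  -- `|j|_v > 1`, `c₄ c₆ ≠ 0`
  have hj := one_lt_norm_j_baseChange_of_hasMultiplicativeReductionAt W v hmult
  obtain ⟨hc₄, hc₆⟩ := c₄_ne_zero_and_c₆_ne_zero_of_hasMultiplicativeReductionAt W v hmult
  -- V.5.3 (a): the Tate parameter `q` and `C : W ⊗ K̄_v ⥲ E_q ⊗ K̄_v`
  obtain ⟨q, hq0, hq, hqj, C, hC⟩ :=
    isomorphic_tateCurve_of_one_lt_norm_j_holds (W.baseChange (v.adicCompletion K)) hj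
  have hq0' : algebraMap (v.adicCompletion K) (AlgebraicClosure (v.adicCompletion K)) q ≠ 0 :=
    (_root_.map_ne_zero _).mpr hq0
  obtain ⟨hEc₄, hEc₆⟩ := tateCurve_c₄_ne_zero_and_c₆_ne_zero W v hq0 hq hqj hj
  -- a square root `t` of `γ(W) = −c₄/c₆`
  obtain ⟨t, ht⟩ := IsAlgClosed.exists_pow_nat_eq
    (algebraMap (v.adicCompletion K) (AlgebraicClosure (v.adicCompletion K))
      (algebraMap K (v.adicCompletion K) (-(W.c₄ / W.c₆)))) two_pos
  have ht0 : t ≠ 0 := by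
    intro h
    have ht' := ht
    rw [h, zero_pow two_ne_zero, eq_comm, map_eq_zero, map_eq_zero, neg_eq_zero,
      div_eq_zero_iff] at ht'
    exact ht'.elim hc₄ hc₆
  -- Tate's `φ` (V.3.1 (c),(d)) and the isomorphism of point groups `e = C` with its sign (V.5.2 (c))
  obtain ⟨φ, hsurj, hker, hequiv, hrat⟩ := uniformization_holds q hq0 hq
  obtain ⟨e, he⟩ : ∃ e : localPoints W (v.adicCompletion K) ≃+ geomPoints (tateCurve q),
      ∀ P, e P = Affine.Point.congrEquiv hC (VariableChange.pointEquiv _ C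
        (Affine.Point.congrEquiv (W.baseChange_baseChange_adicCompletion v).symm P)) :=
    ⟨(Affine.Point.congrEquiv (W.baseChange_baseChange_adicCompletion v).symm).trans
      ((VariableChange.pointEquiv ((W.baseChange (v.adicCompletion K)).baseChange
        (AlgebraicClosure (v.adicCompletion K))) C).trans (Affine.Point.congrEquiv hC)),
      fun _ ↦ rfl⟩
  have hsign := smul_eq_sign_smul W v hc₄ hc₆ hq hEc₄ hEc₆ C hC ht e he
  -- `i = √−1`, `Q = q^{1/4}`
  obtain ⟨i, hi⟩ := IsAlgClosed.exists_pow_nat_eq (-1 : AlgebraicClosure (v.adicCompletion K)) two_pos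
  have hi0 : i ≠ 0 := by
    rintro rfl
    norm_num at hi
  have hi4 : IsPrimitiveRoot i 4 := isPrimitiveRoot_four_of_sq_eq_neg_one hi
  have hi4' : i ^ 4 = 1 := hi4.pow_eq_one
  obtain ⟨Q, hQ⟩ := IsAlgClosed.exists_pow_nat_eq
    (algebraMap (v.adicCompletion K) (AlgebraicClosure (v.adicCompletion K)) q) (by norm_num : 0 < 4)
  have hQ0 : Q ≠ 0 := by
    rintro rfl
    rw [zero_pow four_ne_zero] at hQ
    exact hq0' hQ.symm
  set iu : (AlgebraicClosure (v.adicCompletion K))ˣ := Units.mk0 i hi0 with hiu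
  set Qu : (AlgebraicClosure (v.adicCompletion K))ˣ := Units.mk0 Q hQ0 with hQu
  -- the Kummer step
  obtain ⟨hq₁, hq₂, hq₃, hq₄⟩ := tateParameter_not_mem_sq_classes W v hmult hodd hq0 hq hqj
  obtain ⟨τ, j, hτi, hτt, hτQ, hj⟩ := exists_gal_fix_smul_fourthRoot_eq hq₁ hq₂ hq₃ hq₄ hi hQ ht ht0
  have hτi' : absoluteGaloisGroup.toAlgEquiv _ τ i = i := by rw [← absoluteGaloisGroup.smul_def]; exact hτi
  have hτt' : absoluteGaloisGroup.toAlgEquiv _ τ t = t := by rw [← absoluteGaloisGroup.smul_def]; exact hτt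
  have hτQ' : absoluteGaloisGroup.toAlgEquiv _ τ Q = i ^ j * Q := by
    rw [← absoluteGaloisGroup.smul_def]; exact hτQ
  -- `χ(τ) = 1`: `τ` commutes with `e`
  have hsignτ : ∀ P, τ • e P = e (τ • P) := fun P ↦ by
    have h := hsign τ P
    rwa [if_pos hτt', one_zsmul] at h
  -- the points `P₁ = φ(i)`, `P_Q = φ(Q)`; the action of `τ` on `φ(u)`
  set P₁ : geomPoints (tateCurve q) := φ (Additive.ofMul iu) with hP₁
  set PQ : geomPoints (tateCurve q) := φ (Additive.ofMul Qu) with hPQ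
  have hτu : ∀ u : (AlgebraicClosure (v.adicCompletion K))ˣ, τ • φ (Additive.ofMul u) =
      φ (Additive.ofMul (Units.map (absoluteGaloisGroup.toAlgEquiv _ τ :
        AlgebraicClosure (v.adicCompletion K) →* AlgebraicClosure (v.adicCompletion K)) u)) := hequiv τ
  have hτiu : Units.map (absoluteGaloisGroup.toAlgEquiv _ τ :
      AlgebraicClosure (v.adicCompletion K) →* AlgebraicClosure (v.adicCompletion K)) iu = iu :=
    Units.ext (by rw [Units.coe_map, MonoidHom.coe_coe, hiu, Units.val_mk0, hτi'])
  have hτP₁ : τ • P₁ = P₁ := by rw [hP₁, hτu, hτiu]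
  -- for `u` with `(τ u / u)^4 = 1`: `τ • φ(u) = b • P₁ + φ(u)`
  have hrot : ∀ u : (AlgebraicClosure (v.adicCompletion K))ˣ,
      ((Units.map (absoluteGaloisGroup.toAlgEquiv _ τ :
        AlgebraicClosure (v.adicCompletion K) →* AlgebraicClosure (v.adicCompletion K)) u * u⁻¹ :
          (AlgebraicClosure (v.adicCompletion K))ˣ) : AlgebraicClosure (v.adicCompletion K)) ^ 4 = 1 →
      ∃ b : ℕ, τ • φ (Additive.ofMul u) = b • P₁ + φ (Additive.ofMul u) := by
    intro u hu
    obtain ⟨b, -, hb⟩ := hi4.eq_pow_of_pow_eq_one hu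
    refine ⟨b, ?_⟩
    have hmap : Units.map (absoluteGaloisGroup.toAlgEquiv _ τ :
        AlgebraicClosure (v.adicCompletion K) →* AlgebraicClosure (v.adicCompletion K)) u = iu ^ b * u := by
      have : iu ^ b = Units.map (absoluteGaloisGroup.toAlgEquiv _ τ :
          AlgebraicClosure (v.adicCompletion K) →* AlgebraicClosure (v.adicCompletion K)) u * u⁻¹ :=
        Units.ext (by rw [Units.val_pow_eq_pow_val, hiu, Units.val_mk0, hb])
      rw [this, inv_mul_cancel_right]
    rw [hτu, hmap, ofMul_mul, map_add, ofMul_pow, map_nsmul, hP₁]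
  -- (i) unipotency on the `4`-torsion of `E_q(K̄_v)`
  have hunip : ∀ T : geomPoints (tateCurve q), (4 : ℤ) • T = 0 → τ • (τ • T - T) = τ • T - T := by
    intro T hT
    obtain ⟨x, rfl⟩ := hsurj T
    obtain ⟨u, rfl⟩ : ∃ u : (AlgebraicClosure (v.adicCompletion K))ˣ, Additive.ofMul u = x :=
      ⟨Additive.toMul x, rfl⟩
    obtain ⟨k, hk⟩ := (zsmul_phi_eq_zero_iff hker u 4).mp (by exact_mod_cast hT)
    have hw : ((Units.map (absoluteGaloisGroup.toAlgEquiv _ τ :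
        AlgebraicClosure (v.adicCompletion K) →* AlgebraicClosure (v.adicCompletion K)) u * u⁻¹ :
          (AlgebraicClosure (v.adicCompletion K))ˣ) : AlgebraicClosure (v.adicCompletion K)) ^ 4 = 1 := by
      rw [Units.val_mul, Units.val_inv_eq_inv_val, Units.coe_map, MonoidHom.coe_coe, mul_pow, inv_pow,
        ← map_pow, hk, map_zpow₀, AlgEquiv.commutes, mul_inv_cancel₀ (zpow_ne_zero k hq0')]
    obtain ⟨b, hb⟩ := hrot u hw
    rw [hb, add_sub_cancel_right, smul_comm τ b P₁, hτP₁]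
  -- (ii) the moved `2`-torsion point `φ(Q²)`
  have h2PQ2 : (2 : ℤ) • φ (Additive.ofMul (Qu ^ 2)) = 0 := by
    rw [show (2 : ℤ) = ((2 : ℕ) : ℤ) by rfl, zsmul_phi_eq_zero_iff hker]
    refine ⟨1, ?_⟩
    rw [zpow_one, Units.val_pow_eq_pow_val, hQu, Units.val_mk0, ← pow_mul]
    exact hQ
  have hmove : τ • φ (Additive.ofMul (Qu ^ 2)) ≠ φ (Additive.ofMul (Qu ^ 2)) := by
    intro h
    have hmap : Units.map (absoluteGaloisGroup.toAlgEquiv _ τ :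
        AlgebraicClosure (v.adicCompletion K) →* AlgebraicClosure (v.adicCompletion K)) (Qu ^ 2) =
        iu ^ (2 * j) * Qu ^ 2 :=
      Units.ext (by
        rw [Units.coe_map, MonoidHom.coe_coe, Units.val_mul, Units.val_pow_eq_pow_val, Units.val_pow_eq_pow_val,
          hiu, hQu, Units.val_mk0, Units.val_mk0, map_pow, hτQ', mul_pow, ← pow_mul, mul_comm j 2])
    rw [hτu, hmap, ofMul_mul, map_add, add_eq_right, hker] at h
    obtain ⟨n, hn⟩ := h
    rw [Units.val_pow_eq_pow_val, hiu, Units.val_mk0, pow_mul, hi, Odd.neg_one_pow (Nat.odd_iff.mpr (by omega))]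
      at hn
    -- `-1 = q^n`: squaring, `q^(2n) = 1`, so `n = 0` and `-1 = 1`
    have h1 : algebraMap (v.adicCompletion K) (AlgebraicClosure (v.adicCompletion K)) q ^ (2 * n) = 1 := by
      rw [mul_comm, zpow_mul, ← hn]; norm_num
    have hn0 : 2 * n = 0 := (zpow_algebraMap_eq_one_iff hq0 hq (2 * n)).mp h1
    have : n = 0 := by omega
    rw [this, zpow_zero] at hn
    norm_num at hn
  -- (iii) principality of local Kummer cocycles on `τ`
  have hprinc : ∀ P' : geomPoints (tateCurve q),
      (∀ σ : absoluteGaloisGroup (v.adicCompletion K), absoluteGaloisGroup.toAlgEquiv _ σ t = t →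
        σ • ((4 : ℤ) • P') = (4 : ℤ) • P') →
      ∃ M' : geomPoints (tateCurve q), (4 : ℤ) • M' = 0 ∧ τ • P' - P' = τ • M' - M' := by
    intro P' hP'
    -- `4P' = φ(u₀)` with `u₀ ∈ K_v(t)` (V.3.1 (d))
    have hfix : ∀ σ : absoluteGaloisGroup (v.adicCompletion K),
        absoluteGaloisGroup.toAlgEquiv (v.adicCompletion K) σ ∈
          (IntermediateField.adjoin (v.adicCompletion K)
            ({t} : Set (AlgebraicClosure (v.adicCompletion K)))).fixingSubgroup →
          σ • ((4 : ℤ) • P') = (4 : ℤ) • P' := by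
      intro σ hσ
      exact hP' σ ((IntermediateField.mem_fixingSubgroup_iff _ _).mp hσ t
        (IntermediateField.mem_adjoin_simple_self _ t))
    obtain ⟨u₀, hu₀, hφu₀⟩ := hrat _ _ hfix
    -- `τ` fixes `u₀`
    have hτu₀ : absoluteGaloisGroup.toAlgEquiv _ τ (u₀ : AlgebraicClosure (v.adicCompletion K)) = u₀ := by
      have hle : IntermediateField.adjoin (v.adicCompletion K)
          ({t} : Set (AlgebraicClosure (v.adicCompletion K))) ≤
          IntermediateField.fixedField (MulAction.stabilizer
            (AlgebraicClosure (v.adicCompletion K) ≃ₐ[v.adicCompletion K]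
              AlgebraicClosure (v.adicCompletion K)) t) := by
        rw [IntermediateField.adjoin_simple_le_iff, IntermediateField.mem_fixedField_iff]
        intro f hf
        exact MulAction.mem_stabilizer_iff.mp hf
      exact (IntermediateField.mem_fixedField_iff _ _).mp (hle hu₀)
        (absoluteGaloisGroup.toAlgEquiv _ τ) (MulAction.mem_stabilizer_iff.mpr hτt')
    -- a fourth root `ρ₀` of `u₀`, `R' = φ(ρ₀)`, `4 R' = 4 P'`
    obtain ⟨ρ₀, hρ₀⟩ := IsAlgClosed.exists_pow_nat_eq (u₀ : AlgebraicClosure (v.adicCompletion K))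
      (by norm_num : 0 < 4)
    have hρ₀0 : ρ₀ ≠ 0 := by
      rintro rfl
      rw [zero_pow four_ne_zero] at hρ₀
      exact u₀.ne_zero hρ₀.symm
    set ρu : (AlgebraicClosure (v.adicCompletion K))ˣ := Units.mk0 ρ₀ hρ₀0 with hρu
    have hρu4 : ρu ^ 4 = u₀ := Units.ext (by rw [Units.val_pow_eq_pow_val, hρu, Units.val_mk0, hρ₀])
    have h4R : (4 : ℤ) • φ (Additive.ofMul ρu) = (4 : ℤ) • P' := by
      rw [← hφu₀, ← hρu4, ofMul_pow, map_nsmul, ← natCast_zsmul]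
      rfl
    -- `τ ρ₀ / ρ₀ ∈ μ₄`
    have hw : ((Units.map (absoluteGaloisGroup.toAlgEquiv _ τ :
        AlgebraicClosure (v.adicCompletion K) →* AlgebraicClosure (v.adicCompletion K)) ρu * ρu⁻¹ :
          (AlgebraicClosure (v.adicCompletion K))ˣ) : AlgebraicClosure (v.adicCompletion K)) ^ 4 = 1 := by
      rw [Units.val_mul, Units.val_inv_eq_inv_val, Units.coe_map, MonoidHom.coe_coe, mul_pow, inv_pow,
        ← map_pow, hρu, Units.val_mk0, hρ₀, hτu₀, mul_inv_cancel₀ u₀.ne_zero]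
    obtain ⟨b, hb⟩ := hrot ρu hw
    -- `(τ - 1) P_Q = j • P₁`, and `j` is odd: `b • P₁ = (τ - 1)((b * j) • P_Q)`
    have hτPQ : τ • PQ = j • P₁ + PQ := by
      have hmap : Units.map (absoluteGaloisGroup.toAlgEquiv _ τ :
          AlgebraicClosure (v.adicCompletion K) →* AlgebraicClosure (v.adicCompletion K)) Qu = iu ^ j * Qu :=
        Units.ext (by
          rw [Units.coe_map, MonoidHom.coe_coe, Units.val_mul, Units.val_pow_eq_pow_val, hiu, hQu,
            Units.val_mk0, Units.val_mk0, hτQ'])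
      rw [hPQ, hτu, hmap, ofMul_mul, map_add, ofMul_pow, map_nsmul, hP₁]
    have h4P₁ : (4 : ℕ) • P₁ = 0 := by
      rw [hP₁, ← map_nsmul, ← ofMul_pow, hker]
      exact ⟨0, by rw [zpow_zero, Units.val_pow_eq_pow_val, hiu, Units.val_mk0, hi4']⟩
    have h4PQ : (4 : ℤ) • PQ = 0 := by
      rw [hPQ, show (4 : ℤ) = ((4 : ℕ) : ℤ) by rfl, zsmul_phi_eq_zero_iff hker]
      exact ⟨1, by rw [zpow_one, hQu, Units.val_mk0, hQ]⟩
    obtain ⟨a, ha⟩ : ∃ a : ℕ, j = 2 * a + 1 := ⟨j / 2, by omega⟩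
    have hbj : (b * j * j) • P₁ = b • P₁ := by
      have : b * j * j = b + (b * (a * a + a)) * 4 := by rw [ha]; ring
      rw [this, add_smul, mul_smul, h4P₁, smul_zero, add_zero]
    have hkey : τ • ((b * j) • PQ) - (b * j) • PQ = b • P₁ := by
      rw [smul_comm τ (b * j) PQ, hτPQ, smul_add, add_sub_cancel_right, ← mul_smul, hbj]
    -- `m' = P' - R'` is `4`-torsion
    refine ⟨(b * j) • PQ + (P' - φ (Additive.ofMul ρu)), ?_, ?_⟩
    · rw [smul_add, smul_sub, h4R, sub_self, add_zero, smul_comm, h4PQ, smul_zero]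
    · rw [smul_add, smul_sub, hb]
      have := hkey
      -- rearrange: `τP' - P' = (τ((bj)P_Q) - (bj)P_Q) + (τP' - τR') ... `
      rw [sub_eq_iff_eq_add] at this
      rw [this]
      abel
  -- transport to `W(K̄_v)` through `e`
  refine ⟨τ, fun P hP ↦ ?_, ⟨e.symm (φ (Additive.ofMul (Qu ^ 2))), ?_, ?_⟩, fun P hP ↦ ?_⟩
  · apply e.injective
    have hT : (4 : ℤ) • e P = 0 := by rw [← map_zsmul, hP, map_zero]
    rw [← hsignτ, map_sub, ← hsignτ, hunip (e P) hT]
  · apply e.injective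
    rw [map_zsmul, e.apply_symm_apply, map_zero, h2PQ2]
  · intro h
    have h' := hsignτ (e.symm (φ (Additive.ofMul (Qu ^ 2))))
    rw [h, e.apply_symm_apply] at h'
    exact hmove h'
  · have hP' : ∀ σ : absoluteGaloisGroup (v.adicCompletion K), absoluteGaloisGroup.toAlgEquiv _ σ t = t →
        σ • ((4 : ℤ) • e P) = (4 : ℤ) • e P := by
      intro σ hσt
      have h := hsign σ ((4 : ℤ) • P)
      rw [if_pos hσt, one_zsmul, hP σ, map_zsmul] at h
      exact h
    obtain ⟨M', hM'4, hM'⟩ := hprinc (e P) hP'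
    refine ⟨e.symm M', ?_, ?_⟩
    · apply e.injective
      rw [map_zsmul, e.apply_symm_apply, map_zero, hM'4]
    · apply e.injective
      rw [map_sub, ← hsignτ, hM', map_sub, ← hsignτ, e.apply_symm_apply]

end Summit.BirchSwinnertonDyer.BirchSwinnertonDyer.Theorems.GenusExact.NonPhantom.TateFour

end
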